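import Literature.AlgebraicGeometry.Motives.MumfordTateGroupRealPointsProductOfCM
import Literature.AlgebraicGeometry.HodgeTheory.CMAbelianVarietyHodgeGroupRealPointsCompactForm
import HarnessLib

/-!
# `MT(H¹(A))(ℝ) ≅ ℝ^×_{>0} × Hg(H¹(A))(ℝ)` and `MT(H¹(A))(ℝ)/Hg(H¹(A))(ℝ) ≅ ℝ^×_{>0}` for EVERY complex abelian variety of CM type;
# `MT(Hᵏ(X))(ℝ) ∩ Z(C) ≅ ℝ^×_{>0} × (Hg(Hᵏ(X))(ℝ) ∩ Z(C))` and `MT(Hᵏ(X))(L)/Hg(Hᵏ(X))(L) ≅ ν(MT(Hᵏ(X))(L))` for every smooth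
# projective `X` and odd `k` (Green–Griffiths–Kerr §I.B; Moonen (5.8); CMSP 15.2 Remark (ii); Deligne 1982 I §5; Gordon 2.12)

Family `hodge`, lane `lit-hodgefound` (Track 2 foundations library; Layer A3 «the Mumford–Tate group of a CM abelian variety is a
torus»), layer `Literature/AlgebraicGeometry/HodgeTheory`.  THEOREMS ONLY (no definition, no named fact, no instance; D-0026 net
debt `0`).  The Betti TRANSPORT of the seat's general `Motives/MumfordTateGroupRealPointsProductOfCM` to the tree's geometric Hodge
structures `Hᵏ(X) = BettiUniverse.hodge hHD hX k` (polarizable by `BettiUniverse.hodge_isPolarizable`) and, through the CM condition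
`hodgeLie_hodge_le_endAlg_of_isOfCMType` of the seat's `HodgeTheory/CMAbelianVarietyHodgeGroupRealPointsCompactForm`, to `H¹` of
EVERY complex abelian variety of CM type (`Milne1999.IsOfCMType`) — the tree's `HodgeTheory/CMBettiMumfordTateRealPointsProduct`
has the realisation-indexed cases (one `A` of type `(K; Φ)`, products) only.

THE PRINTS.  M. Green, P. Griffiths, M. Kerr (2012) [GreenGriffithsKerr2012] §I.B before (I.B.1) «`M_φ̃ = 𝔾_m · M_φ` (almost
direct product)».  B. Moonen (2004) [Moonen2004MT] (5.8) «`Hg := Ker(MT → 𝔾_m)`».  J. Carlson, S. Müller-Stach, C. Peters (2017)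
[CarlsonMullerStachPeters2017] §15.2 Remark (ii) after Def. 15.2.1 «`MT(h) = SMT(h) · h∘w(𝐆_m)` … isogenous to `SMT(h) × G_m`».
P. Deligne (1982) [Deligne1982HodgeCycles] I §5 «of CM-type if its Mumford-Tate group is commutative», Example 3.7 (d).
B. B. Gordon [Gordon1999HodgeAVSurvey] 2.12.  C. Voisin [VoisinHodgeI2002] §7.1.2 / Thm. 6.32 (polarizability of `Hᵏ(X)`).

THE OBJECTS (all the tree's / Mathlib's).  `X : SchemeOver ℂ` with `hX : IsSmoothProjective n X`; `hHD : exists_isReal_hodgeModel`,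
`hI : hodgePQ_independent_of_hodgeModel` (named-fact hypotheses, discharged in the tree); `Hᵏ(X) = BettiUniverse.hodge hHD hX k`, its
points `MT(L)`, `Hg(L)` in `GL(L ⊗ Hᵏ(X; ℚ))`, real Weil operator `C_ℝ`, centralizer `Z(C_ℝ) = Subgroup.centralizer {C_ℝ}`,
a polarization `ψ` with multiplier `ν = ψ.multiplierChar L`; `Units.posSubgroup ℝ = ℝ^×_{>0}`; `A : AbelianVariety ℂ` with
`Milne1999.IsOfCMType A`.  As in the Motives file, quotient statements carry the normality `Hg(L) ⊴ MT(L)` as an INSTANCE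
HYPOTHESIS, discharged by the proved `normal_…` theorems.

WHAT IS PROVED.
* §1 (every smooth projective `X`, odd `k`, `Hᵏ(X) ≠ 0`) **`nonempty_inf_centralizer_hodge_mulEquiv_posSubgroup_prod`**
  (`MT(Hᵏ(X))(ℝ) ⊓ Z(C_ℝ) ≃* ℝ^×_{>0} × (Hg(Hᵏ(X))(ℝ) ⊓ Z(C_ℝ))`), `normal_hodgeGroupBaseChange_hodge_subgroupOf` (`Hg(L) ⊴ MT(L)`),
  `nonempty_quotient_hodgeGroupBaseChange_hodge_mulEquiv_range_multiplierChar` (`MT(L)/Hg(L) ≃* ν(MT(L))`),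
  `range_multiplierChar_hodge_real_eq_posSubgroup_or_eq_top` (dichotomy).
* §2 (EVERY `A` of CM type, `H¹(A) ≠ 0`) **`nonempty_mumfordTateGroupBaseChange_hodge_real_mulEquiv_posSubgroup_prod_of_isOfCMType`**
  — **`MT(H¹(A))(ℝ) ≃* ℝ^×_{>0} × Hg(H¹(A))(ℝ)`** —, `range_multiplierChar_hodge_real_eq_posSubgroup_of_isOfCMType` (`ν(MT(ℝ)) = ℝ^×_{>0}`),
  **`nonempty_quotient_hodgeGroupBaseChange_hodge_real_mulEquiv_posSubgroup_of_isOfCMType`** (`MT(H¹(A))(ℝ)/Hg(H¹(A))(ℝ) ≃* ℝ^×_{>0}`).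

DEVIATIONS / SCOPE.  On points; NOT HERE: even `k`; the realisation-indexed cases (in the tree).

## References
* [GreenGriffithsKerr2012] M. Green, P. A. Griffiths, M. Kerr, *Mumford–Tate Groups and Domains* (2012) — §I.B (before (I.B.1)).
* [Moonen2004MT] B. Moonen, *An introduction to Mumford–Tate groups* (2004) — (5.8).
* [CarlsonMullerStachPeters2017] J. Carlson, S. Müller-Stach, C. Peters, *Period Mappings and Period Domains*, 2nd ed. (2017) — §15.2.
* [Deligne1982HodgeCycles] P. Deligne, *Hodge cycles on abelian varieties*, in LNM 900 (1982) — I §5, Example 3.7 (d).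
* [Gordon1999HodgeAVSurvey] B. B. Gordon, *A survey of the Hodge conjecture for abelian varieties* (1999) — 2.12.
* [VoisinHodgeI2002] C. Voisin, *Hodge Theory and Complex Algebraic Geometry I* (2002) — §7.1.2, Thm. 6.32.

## Provenance
Lane `lit-hodgefound` (Hodge path, Track 2), prover seat `lit-hodgefound-p29` (generation 22), self-proposed row g22-#10 (Betti sequel of
g22-#9 `Motives/MumfordTateGroupRealPointsProductOfCM`).
-/

noncomputable section

open scoped TensorProduct
open CategoryTheory Module

namespace Literature.AlgebraicGeometry.HodgeTheory

open Literature.AlgebraicGeometry.Motives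
open Literature.AlgebraicGeometry.Motives.HodgeStructure
open Literature.AlgebraicGeometry.Milne1999 (IsOfCMType)

universe w

/-! ### §1 Every smooth projective `X`, odd degree -/

section SmoothProjective

variable [HodgeTensorFacts.{0, 0}] {n : ℕ} {X : SchemeOver ℂ} {k : ℕ} [Module.Finite ℚ (bettiCohomology X k)]

/-- **`MT(Hᵏ(X))(ℝ) ⊓ Z(C_ℝ) ≃* ℝ^×_{>0} × (Hg(Hᵏ(X))(ℝ) ⊓ Z(C_ℝ))`** for every smooth projective `X` and odd `k` (`Hᵏ(X) ≠ 0`): on the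
real points commuting with the Weil operator «`M_φ̃ = 𝔾_m · M_φ`» is a direct product.
[cite: GreenGriffithsKerr2012, §I.B (semi-direct product remark before (I.B.1)) and §II.A (PDF p. 45)]
[cite: CarlsonMullerStachPeters2017, §15.2 Remark (ii) after Definition 15.2.1] [cite: VoisinHodgeI2002, §7.1.2 and Thm. 6.32] -/
theorem nonempty_inf_centralizer_hodge_mulEquiv_posSubgroup_prod [Nontrivial (bettiCohomology X k)] (hHD : exists_isReal_hodgeModel)
    (hX : IsSmoothProjective n X) (hk : Odd k) :
    Nonempty (↥((BettiUniverse.hodge hHD hX k).mumfordTateGroupBaseChange ℝ ⊓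
        Subgroup.centralizer {(BettiUniverse.hodge hHD hX k).realWeilOperator}) ≃*
      Units.posSubgroup ℝ × ↥((BettiUniverse.hodge hHD hX k).hodgeGroupBaseChange ℝ ⊓
        Subgroup.centralizer {(BettiUniverse.hodge hHD hX k).realWeilOperator})) :=
  nonempty_inf_centralizer_mulEquiv_posSubgroup_prod _ ((Int.odd_coe_nat k).2 hk) (BettiUniverse.hodge_isPolarizable hHD hX k)

/-- **`Hg(Hᵏ(X))(L) ⊴ MT(Hᵏ(X))(L)`** (odd `k`, `Hᵏ(X) ≠ 0`, every field `L ⊇ ℚ`): the kernel of the multiplier of a polarization.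
[cite: Moonen2004MT, (5.8)] -/
theorem normal_hodgeGroupBaseChange_hodge_subgroupOf [Nontrivial (bettiCohomology X k)] (hHD : exists_isReal_hodgeModel)
    (hX : IsSmoothProjective n X) (hk : Odd k) (L : Type w) [Field L] [Algebra ℚ L] :
    (((BettiUniverse.hodge hHD hX k).hodgeGroupBaseChange L).subgroupOf
      ((BettiUniverse.hodge hHD hX k).mumfordTateGroupBaseChange L)).Normal := by
  obtain ⟨ψ⟩ := BettiUniverse.hodge_isPolarizable hHD hX k
  exact ψ.normal_hodgeGroupBaseChange_subgroupOf _ L ((Int.odd_coe_nat k).2 hk)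

/-- **`1 → Hg(Hᵏ(X))(L) → MT(Hᵏ(X))(L) → ν(MT(Hᵏ(X))(L)) → 1`**: `MT(L)/Hg(L) ≃* ν(MT(L)) ≤ L^×` for odd `k`, `Hᵏ(X) ≠ 0`, every
polarization `ψ` of `Hᵏ(X)` and every field `L ⊇ ℚ`. [cite: Moonen2004MT, (5.8)] [cite: Deligne1982HodgeCycles, I §3 proof of Prop. 3.6] -/
theorem nonempty_quotient_hodgeGroupBaseChange_hodge_mulEquiv_range_multiplierChar [Nontrivial (bettiCohomology X k)]
    (hHD : exists_isReal_hodgeModel) (hX : IsSmoothProjective n X) (hk : Odd k) (L : Type w) [Field L] [Algebra ℚ L]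
    (ψ : (BettiUniverse.hodge hHD hX k).Polarization)
    [(((BettiUniverse.hodge hHD hX k).hodgeGroupBaseChange L).subgroupOf
      ((BettiUniverse.hodge hHD hX k).mumfordTateGroupBaseChange L)).Normal] :
    Nonempty ((BettiUniverse.hodge hHD hX k).mumfordTateGroupBaseChange L ⧸
        ((BettiUniverse.hodge hHD hX k).hodgeGroupBaseChange L).subgroupOf
          ((BettiUniverse.hodge hHD hX k).mumfordTateGroupBaseChange L) ≃* (ψ.multiplierChar L).range) :=
  ψ.nonempty_quotient_hodgeGroupBaseChange_mulEquiv_range_multiplierChar _ L ((Int.odd_coe_nat k).2 hk)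

/-- **Dichotomy `ν(MT(Hᵏ(X))(ℝ)) = ℝ^×_{>0}` or `= ℝ^×`** (`k ≠ 0`, `Hᵏ(X) ≠ 0`, `ψ` a polarization of `Hᵏ(X)`).
[cite: CarlsonMullerStachPeters2017, §15.2 Remark (ii) after Definition 15.2.1 and Examples 15.2.4 (i)] -/
theorem range_multiplierChar_hodge_real_eq_posSubgroup_or_eq_top [Nontrivial (bettiCohomology X k)] (hHD : exists_isReal_hodgeModel)
    (hX : IsSmoothProjective n X) (hk : k ≠ 0) (ψ : (BettiUniverse.hodge hHD hX k).Polarization) :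
    (ψ.multiplierChar ℝ).range = Units.posSubgroup ℝ ∨ (ψ.multiplierChar ℝ).range = ⊤ :=
  ψ.range_multiplierChar_real_eq_posSubgroup_or_eq_top _ (Int.natCast_ne_zero.2 hk)

end SmoothProjective

/-! ### §2 Every complex abelian variety of CM type -/

section OfCMType

variable [HodgeTensorFacts.{0, 0}] {A : AbelianVariety ℂ} {n : ℕ} [Module.Finite ℚ (bettiCohomology A.X 1)]

/-- **`MT(H¹(A))(ℝ) ≃* ℝ^×_{>0} × Hg(H¹(A))(ℝ)` for EVERY complex abelian variety `A` of CM type** (`H¹(A) ≠ 0`): `(t, γ₀) ↦ t · γ₀`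
is a group isomorphism — «`M_φ̃ = 𝔾_m · M_φ`» is an honest direct product on the real points of a CM abelian variety's `H¹`, whose
factor `Hg(H¹(A))(ℝ)` is compact. [cite: GreenGriffithsKerr2012, §I.B (semi-direct product remark before (I.B.1)) and Ch. V (V.4)]
[cite: CarlsonMullerStachPeters2017, §15.2 Remark (ii) after Definition 15.2.1] [cite: Deligne1982HodgeCycles, I §5 and Example 3.7 (d)]
[cite: Gordon1999HodgeAVSurvey, Prop. 2.12] -/
theorem nonempty_mumfordTateGroupBaseChange_hodge_real_mulEquiv_posSubgroup_prod_of_isOfCMType [Nontrivial (bettiCohomology A.X 1)]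
    (hHD : exists_isReal_hodgeModel) (hI : hodgePQ_independent_of_hodgeModel) (hA : IsSmoothProjective n A.X) (hcm : IsOfCMType A) :
    Nonempty ((BettiUniverse.hodge hHD hA 1).mumfordTateGroupBaseChange ℝ ≃*
      Units.posSubgroup ℝ × (BettiUniverse.hodge hHD hA 1).hodgeGroupBaseChange ℝ) :=
  nonempty_mumfordTateGroupBaseChange_real_mulEquiv_posSubgroup_prod_of_hodgeLie_le _ odd_one
    (BettiUniverse.hodge_isPolarizable hHD hA 1) (hodgeLie_hodge_le_endAlg_of_isOfCMType hHD hI hA hcm)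

/-- **`ν(MT(H¹(A))(ℝ)) = ℝ^×_{>0}`** for `A` of CM type (`ψ` any polarization of `H¹(A)`, `H¹(A) ≠ 0`).
[cite: CarlsonMullerStachPeters2017, §15.2 Remark (ii) after Definition 15.2.1] [cite: Deligne1982HodgeCycles, I Example 3.7 (d) and §5] -/
theorem range_multiplierChar_hodge_real_eq_posSubgroup_of_isOfCMType [Nontrivial (bettiCohomology A.X 1)]
    (hHD : exists_isReal_hodgeModel) (hI : hodgePQ_independent_of_hodgeModel) (hA : IsSmoothProjective n A.X) (hcm : IsOfCMType A)
    (ψ : (BettiUniverse.hodge hHD hA 1).Polarization) : (ψ.multiplierChar ℝ).range = Units.posSubgroup ℝ :=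
  ψ.range_multiplierChar_real_eq_posSubgroup_of_hodgeLie_le _ odd_one (hodgeLie_hodge_le_endAlg_of_isOfCMType hHD hI hA hcm)

/-- `Hg(H¹(A))(L) ⊴ MT(H¹(A))(L)` for every abelian variety (`H¹(A) ≠ 0`; weight one is odd). [cite: Moonen2004MT, (5.8)] -/
theorem normal_hodgeGroupBaseChange_hodge_one_subgroupOf [Nontrivial (bettiCohomology A.X 1)] (hHD : exists_isReal_hodgeModel)
    (hA : IsSmoothProjective n A.X) (L : Type w) [Field L] [Algebra ℚ L] :
    (((BettiUniverse.hodge hHD hA 1).hodgeGroupBaseChange L).subgroupOf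
      ((BettiUniverse.hodge hHD hA 1).mumfordTateGroupBaseChange L)).Normal :=
  normal_hodgeGroupBaseChange_hodge_subgroupOf hHD hA odd_one L

/-- **`MT(H¹(A))(ℝ) / Hg(H¹(A))(ℝ) ≃* ℝ^×_{>0}` for EVERY complex abelian variety `A` of CM type** (`H¹(A) ≠ 0`) — «isogenous to
`SMT(h) × G_m`», exactly, on real points modulo the compact `Hg`. [cite: CarlsonMullerStachPeters2017, §15.2 Remark (ii) after Definition 15.2.1]
[cite: Moonen2004MT, (5.8)] [cite: Gordon1999HodgeAVSurvey, Prop. 2.12] -/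
theorem nonempty_quotient_hodgeGroupBaseChange_hodge_real_mulEquiv_posSubgroup_of_isOfCMType [Nontrivial (bettiCohomology A.X 1)]
    (hHD : exists_isReal_hodgeModel) (hI : hodgePQ_independent_of_hodgeModel) (hA : IsSmoothProjective n A.X) (hcm : IsOfCMType A)
    [(((BettiUniverse.hodge hHD hA 1).hodgeGroupBaseChange ℝ).subgroupOf
      ((BettiUniverse.hodge hHD hA 1).mumfordTateGroupBaseChange ℝ)).Normal] :
    Nonempty ((BettiUniverse.hodge hHD hA 1).mumfordTateGroupBaseChange ℝ ⧸
        ((BettiUniverse.hodge hHD hA 1).hodgeGroupBaseChange ℝ).subgroupOf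
          ((BettiUniverse.hodge hHD hA 1).mumfordTateGroupBaseChange ℝ) ≃* Units.posSubgroup ℝ) :=
  nonempty_quotient_hodgeGroupBaseChange_real_mulEquiv_posSubgroup_of_hodgeLie_le _ odd_one
    (BettiUniverse.hodge_isPolarizable hHD hA 1) (hodgeLie_hodge_le_endAlg_of_isOfCMType hHD hI hA hcm)

end OfCMType

end Literature.AlgebraicGeometry.HodgeTheory

end
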